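import Mathlib.Combinatorics.SetFamily.FourFunctions
import Mathlib.Analysis.SpecificLimits.Normed
import Literature.Probability.LatticeModels.MeanFieldBoundGHS
import Literature.Probability.LatticeModels.PlusStateFKG
import HarnessLib

/-!
# Comparison of the free and plus states: Holley domination, the Lebowitz–Martin-Löf criterion,
# and the GHS boundary-field bound

Topic `Probability/LatticeModels`, namespace `Literature.StatMech` (general locally finite graphs and
`ℤ^d`). This file proves, sorry-free and from the tree's finite-volume theory (`GKSInequalities`,
`MeanFieldBoundGHS`, `IsingFKG`, `PlusStateFKG`), classical comparison
results between the free (`∅`) and plus (`+`) boundary conditions of the nearest-neighbour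
Ising model at zero field, which are the "soft" inputs c), d) of the Benettin–Gallavotti–
Jona-Lasinio–Stella proof of the Onsager–Yang formula (`OnsagerYang.lean`; there imported from
Lebowitz–Martin-Löf, CMP 25 (1972) and Lebowitz, CMP 28 (1972)):

* **Holley domination `μ^∅_Λ ≼ μ⁺_Λ`** (`isingExpect_free_le_plus_of_monotone`): for `β ≥ 0`, any
  field `h` and every nondecreasing observable `f`, `⟨f⟩^∅_{Λ;β,h} ≤ ⟨f⟩⁺_{Λ;β,h}` — the free
  and plus Gibbs weights satisfy Holley's condition (Holley, CMP 36 (1974) 227; Friedli–Velenik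
  2017, Lemma 3.23 / eq. (3.25) for the comparison of boundary conditions via FKG), and Mathlib's
  `holley` (four functions theorem) applies on the distributive lattice `{−1,+1}^Λ`.
* **Spin-flip symmetry of the free state** (`isingCorr_free_of_odd_card_holds`, discharging the
  prelude fact `isingCorr_free_of_odd_card` of `IsingModel`): `⟨σ_A⟩^∅_{Λ;β,0} = 0` for `A ⊆ Λ`
  of odd cardinality (Friedli–Velenik 2017, eq. (3.33)).
* **The Lebowitz–Martin-Löf criterion, free/plus form** (`freeCorr_eq_plusCorr_of_spontaneousMagnetization_eq_zero`):
  on `ℤ^d`, `β ≥ 0`, if `m*(β) = 0` then `⟨σ_A⟩^∅_{β,0} = ⟨σ_A⟩⁺_{β,0}` for every finite `A`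
  (Lebowitz–Martin-Löf, CMP 25 (1972) 276, Theorem; Friedli–Velenik 2017, Thm. 3.28, proof of
  3 ⇒ 2 with the increasing functions `∑_{i∈A} n_i − n_A`, here run between `∅` and `+` instead
  of `−` and `+`, followed by Möbius inversion over `A`).
* **Exponential decay of the free two-point function forces `m* = 0`**
  (`spontaneousMagnetization_eq_zero_of_twoPointFree_exp_decay`): on `ℤ^d`, `β ≥ 0`, if
  `⟨σ₀σ_x⟩^∅_{β,0} ≤ K e^{-κ‖x‖_∞}` with `κ > 0` then `m*(β) = 0` — the mechanism of Lebowitz, CMP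
  28 (1972), §§II–III (there routed through the differentiability of the pressure in `h`; here
  directly through the GHS boundary-field bound of the tree, `MeanFieldBoundGHS`'s
  `spontaneousMagnetization_le_boundary_twoPoint`, whose right side is `O(L^d e^{-κL}) → 0`).

## Mathlib status

Mathlib has no Ising model. Anchors: `holley` (`Mathlib.Combinatorics.SetFamily.FourFunctions`),
`Finset.prod_add`, `Fintype.sum_bijective`, `tendsto_pow_const_mul_const_pow_of_abs_lt_one`,
`Finset.strongInduction`.

## References

* R. Holley, *Remarks on the FKG inequalities*, Comm. Math. Phys. 36 (1974) 227–231.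
* J. L. Lebowitz, A. Martin-Löf, Comm. Math. Phys. 25 (1972) 276–282.
* J. L. Lebowitz, Comm. Math. Phys. 28 (1972) 313–321; Comm. Math. Phys. 35 (1974) 87–92.
* R. B. Griffiths, C. A. Hurst, S. Sherman, J. Math. Phys. 11 (1970) 790–795.
* S. Friedli, Y. Velenik, *Statistical Mechanics of Lattice Systems* (CUP 2017), Lemma 3.19,
  Lemma 3.23, Thm. 3.28, eq. (3.33), Exercise 3.10.
-/

noncomputable section

open MeasureTheory Filter Topology Finset Literature.Probability.LatticeModels Literature.Probability.Percolation

namespace Literature.Probability.LatticeModels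

/-! ### Holley domination of the free state by the plus state in finite volume -/

section Holley

variable {V : Type*} (G : SimpleGraph V) [DecidableEq V] [G.LocallyFinite]

/-- A boundary bond of the plus boundary condition is a nondecreasing function of the inside
configuration: for `e = {u, v}` not inside `Λ`, `τ ↦ σ_e(τ · +)` is monotone (the outside spin is
frozen to `+1`, the inside one is nondecreasing). [folklore] -/
theorem bondSpin_glue_plus_monotone (Λ : Finset V) {e : Sym2 V} (he : ¬ ∀ x ∈ e, x ∈ Λ) :
    Monotone fun τ : Λ → ℤˣ => bondSpin (glue Λ τ .plus) e := by
  induction e using Sym2.ind with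
  | _ u v =>
    intro τ τ' hle
    simp only [bondSpin_mk]
    have hmono : ∀ x : V, spinAt x (glue Λ τ .plus) ≤ spinAt x (glue Λ τ' .plus) := fun x =>
      spinAt_mono x (glue_monotone Λ .plus hle)
    have hout : ∀ x : V, x ∉ Λ → ∀ ρ : Λ → ℤˣ, spinAt x (glue Λ ρ .plus) = 1 := fun x hx ρ => by
      simp [spinAt, glue_apply_of_notMem Λ ρ _ hx, BoundaryCondition.plus]
    by_cases hu : u ∈ Λ
    · have hv : v ∉ Λ := fun hv => he (fun x hx => by
        rcases Sym2.mem_iff.1 hx with rfl | rfl <;> assumption)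
      rw [hout v hv τ, hout v hv τ', mul_one, mul_one]
      exact hmono u
    · rw [hout u hu τ, hout u hu τ', one_mul, one_mul]
      exact hmono v

/-- The plus Hamiltonian is the free Hamiltonian plus the boundary bonds:
`-H⁺_{Λ;h}(σ) = -H^∅_{Λ;h}(σ) + ∑_{e ∈ ℰ^b_Λ ∖ ℰ_Λ} σ_e` (Friedli–Velenik 2017, §3.1, eqs. (3.2),
(3.6)). [cite: FriedliVelenik2017, §3.1, eqs. (3.2) and (3.6)] -/
theorem neg_isingHamiltonian_plus_eq (Λ : Finset V) (h : ℝ) (σ : SpinConfig V) :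
    -isingHamiltonian G Λ h .plus σ =
      -isingHamiltonian G Λ h .free σ + ∑ e ∈ edgesTouching G Λ \ edgesIn G Λ, bondSpin σ e := by
  simp only [isingHamiltonian, BoundaryCondition.plus, interactionEdges_fixed,
    interactionEdges_free]
  rw [← Finset.sum_sdiff (edgesIn_subset_edgesTouching (G := G) Λ)]
  ring

/-- **Holley's condition for the pair (free, plus)**: for `β ≥ 0` and every field `h`,
`w^∅(τ) w⁺(τ') ≤ w^∅(τ ∧ τ') w⁺(τ ∨ τ')` (the free energy is supermodular, Friedli–Velenik 2017,
§3.8.3, and the boundary bonds of `+` are nondecreasing). [cite: Holley1974, Theorem (condition (5))] -/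
theorem isingWeight_free_plus_holley (Λ : Finset V) {β : ℝ} (hβ : 0 ≤ β) (h : ℝ)
    (τ τ' : Λ → ℤˣ) :
    isingWeight G Λ β h .free τ * isingWeight G Λ β h .plus τ' ≤
      isingWeight G Λ β h .free (τ ⊓ τ') * isingWeight G Λ β h .plus (τ ⊔ τ') := by
  simp only [isingWeight, ← Real.exp_add]
  refine Real.exp_le_exp.2 ?_
  rw [glue_free_eq_glue_plus Λ τ, glue_free_eq_glue_plus Λ (τ ⊓ τ')]
  have hsuper := neg_isingHamiltonian_supermodular G Λ h .free (glue Λ τ .plus) (glue Λ τ' .plus)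
  rw [← glue_inf, ← glue_sup] at hsuper
  have hbd : ∑ e ∈ edgesTouching G Λ \ edgesIn G Λ, bondSpin (glue Λ τ' .plus) e ≤
      ∑ e ∈ edgesTouching G Λ \ edgesIn G Λ, bondSpin (glue Λ (τ ⊔ τ') .plus) e := by
    refine Finset.sum_le_sum fun e he => ?_
    have he' : ¬ ∀ x ∈ e, x ∈ Λ := by
      intro hall
      rw [Finset.mem_sdiff, mem_edgesTouching_iff, mem_edgesIn_iff] at he
      exact he.2 ⟨he.1.1, hall⟩
    exact bondSpin_glue_plus_monotone Λ he' (le_sup_right : τ' ≤ τ ⊔ τ')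
  have e1 := neg_isingHamiltonian_plus_eq G Λ h (glue Λ τ' .plus)
  have e2 := neg_isingHamiltonian_plus_eq G Λ h (glue Λ (τ ⊔ τ') .plus)
  have key : -isingHamiltonian G Λ h .free (glue Λ τ .plus) +
      -isingHamiltonian G Λ h .plus (glue Λ τ' .plus) ≤
      -isingHamiltonian G Λ h .free (glue Λ (τ ⊓ τ') .plus) +
        -isingHamiltonian G Λ h .plus (glue Λ (τ ⊔ τ') .plus) := by
    rw [e1, e2]
    linarith
  have := mul_le_mul_of_nonneg_left key hβ
  linarith

/-- **Holley domination `μ^∅_{Λ;β,h} ≼ μ⁺_{Λ;β,h}`** (Holley, CMP 36 (1974) 227, Theorem;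
Friedli–Velenik 2017, Lemma 3.23 and eq. (3.25): expectations of nondecreasing functions increase
from free to plus boundary condition): for `β ≥ 0`, any `h ∈ ℝ` and every nondecreasing measurable
`f`, `⟨f⟩^∅_{Λ;β,h} ≤ ⟨f⟩⁺_{Λ;β,h}`. Proof: Holley's inequality on the finite distributive lattice
`{−1,+1}^Λ` (Mathlib `holley`) for the normalised weights, applied to the nonnegative shift
`f ∘ glue + C`. [cite: Holley1974, Theorem] -/
theorem isingExpect_free_le_plus_of_monotone (Λ : Finset V) {β : ℝ} (hβ : 0 ≤ β) (h : ℝ)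
    {f : SpinConfig V → ℝ} (hf : Monotone f) (hfm : Measurable f) :
    isingExpect G Λ β h .free f ≤ isingExpect G Λ β h .plus f := by
  classical
  set wf : (Λ → ℤˣ) → ℝ := isingWeight G Λ β h .free with hwf
  set wp : (Λ → ℤˣ) → ℝ := isingWeight G Λ β h .plus with hwp
  set Zf : ℝ := ∑ τ, wf τ with hZf
  set Zp : ℝ := ∑ τ, wp τ with hZp
  have hZf0 : 0 < Zf := Finset.sum_pos (fun τ _ => isingWeight_pos G Λ β h _ τ) Finset.univ_nonempty
  have hZp0 : 0 < Zp := Finset.sum_pos (fun τ _ => isingWeight_pos G Λ β h _ τ) Finset.univ_nonempty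
  set F : (Λ → ℤˣ) → ℝ := fun τ => f (glue Λ τ .plus) with hF
  have hFm : Monotone F := fun τ τ' hle => hf (glue_monotone Λ .plus hle)
  set C : ℝ := ∑ τ, |F τ| with hC
  set μ : (Λ → ℤˣ) → ℝ := fun τ => F τ + C with hμ
  have hμ0 : 0 ≤ μ := fun τ => by
    have h1 : |F τ| ≤ C :=
      Finset.single_le_sum (f := fun τ => |F τ|) (fun _ _ => abs_nonneg _) (Finset.mem_univ τ)
    simp only [Pi.zero_apply, hμ]
    linarith [neg_abs_le (F τ)]
  have hμm : Monotone μ := hFm.add_const C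
  -- normalised weights
  set pf : (Λ → ℤˣ) → ℝ := fun τ => wf τ / Zf with hpf
  set pp : (Λ → ℤˣ) → ℝ := fun τ => wp τ / Zp with hpp
  have hpf0 : 0 ≤ pf := fun τ => div_nonneg (isingWeight_pos G Λ β h _ τ).le hZf0.le
  have hpp0 : 0 ≤ pp := fun τ => div_nonneg (isingWeight_pos G Λ β h _ τ).le hZp0.le
  have hsum : ∑ τ, pf τ = ∑ τ, pp τ := by
    simp only [hpf, hpp]
    rw [← Finset.sum_div, ← Finset.sum_div, div_self hZf0.ne', div_self hZp0.ne']
  have hcond : ∀ a b, pf a * pp b ≤ pf (a ⊓ b) * pp (a ⊔ b) := by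
    intro a b
    simp only [hpf, hpp]
    rw [div_mul_div_comm, div_mul_div_comm]
    exact div_le_div_of_nonneg_right (isingWeight_free_plus_holley G Λ hβ h a b)
      (mul_pos hZf0 hZp0).le
  have key := holley pf pp μ hμ0 hpf0 hpp0 hμm hsum hcond
  -- unfold the conclusion
  have e1 : ∑ τ, μ τ * pf τ = (∑ τ, wf τ * F τ) / Zf + C := by
    simp only [hμ, hpf, add_mul, Finset.sum_add_distrib]
    rw [Finset.sum_div]
    congr 1
    · exact Finset.sum_congr rfl fun τ _ => by ring
    · rw [← Finset.mul_sum, ← Finset.sum_div, div_self hZf0.ne', mul_one]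
  have e2 : ∑ τ, μ τ * pp τ = (∑ τ, wp τ * F τ) / Zp + C := by
    simp only [hμ, hpp, add_mul, Finset.sum_add_distrib]
    rw [Finset.sum_div]
    congr 1
    · exact Finset.sum_congr rfl fun τ _ => by ring
    · rw [← Finset.mul_sum, ← Finset.sum_div, div_self hZp0.ne', mul_one]
  rw [e1, e2, add_le_add_iff_right] at key
  have hexpF : isingExpect G Λ β h .free f = (∑ τ, wf τ * F τ) / Zf := by
    rw [isingExpect_eq_sum_div G Λ h _ β hfm]
    simp only [glue_free_eq_glue_plus]
    rfl
  have hexpP : isingExpect G Λ β h .plus f = (∑ τ, wp τ * F τ) / Zp := by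
    rw [isingExpect_eq_sum_div G Λ h _ β hfm]
    rfl
  rw [hexpF, hexpP]
  exact key

end Holley

/-! ### Spin-flip symmetry of the free measure at zero field -/

section SpinFlip

variable {V : Type*} (G : SimpleGraph V) [DecidableEq V] [G.LocallyFinite]

omit [DecidableEq V] in
/-- Flipping the inside configuration flips the inside spins: `σ_x((-τ)·bc) = -σ_x(τ·bc)` for
`x ∈ Λ`. [folklore] -/
theorem spinAt_glue_neg_of_mem (Λ : Finset V) (τ : Λ → ℤˣ) (bc : BoundaryCondition V) {x : V}
    (hx : x ∈ Λ) : spinAt x (glue Λ (-τ) bc) = -spinAt x (glue Λ τ bc) := by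
  simp [spinAt, glue_apply_of_mem Λ _ bc hx]

omit [DecidableEq V] in
/-- `σ_A((-τ)·bc) = (-1)^{|A|} σ_A(τ·bc)` for `A ⊆ Λ` (Friedli–Velenik 2017, §3.7.1). [cite: FriedliVelenik2017, §3.7.1] -/
theorem spinProduct_glue_neg_of_subset {Λ A : Finset V} (hA : A ⊆ Λ) (τ : Λ → ℤˣ)
    (bc : BoundaryCondition V) :
    spinProduct A (glue Λ (-τ) bc) = (-1) ^ #A * spinProduct A (glue Λ τ bc) := by
  rw [spinProduct, spinProduct, ← Finset.prod_neg]
  exact Finset.prod_congr rfl fun x hx => spinAt_glue_neg_of_mem Λ τ bc (hA hx)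

/-- The free Hamiltonian at zero field is invariant under the global flip of the inside
configuration (every interacting edge lies inside `Λ`; Friedli–Velenik 2017, §3.7.1, spin-flip
symmetry, eq. (3.33)). [cite: FriedliVelenik2017, §3.7.1, eq. (3.33)] -/
theorem isingHamiltonian_free_zero_glue_neg (Λ : Finset V) (τ : Λ → ℤˣ) :
    isingHamiltonian G Λ 0 .free (glue Λ (-τ) .free) =
      isingHamiltonian G Λ 0 .free (glue Λ τ .free) := by
  simp only [isingHamiltonian, interactionEdges_free, zero_mul, sub_zero, neg_inj]
  refine Finset.sum_congr rfl fun e he => ?_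
  rw [mem_edgesIn_iff] at he
  obtain ⟨-, he⟩ := he
  induction e using Sym2.ind with
  | _ u v =>
    rw [bondSpin_mk, bondSpin_mk, spinAt_glue_neg_of_mem Λ τ _ (he u (Sym2.mem_mk_left u v)),
      spinAt_glue_neg_of_mem Λ τ _ (he v (Sym2.mem_mk_right u v))]
    ring

/-- The free Gibbs weights at zero field are flip invariant: `w^∅_{Λ;β,0}(-τ) = w^∅_{Λ;β,0}(τ)`. [cite: FriedliVelenik2017, §3.7.1, eq. (3.33)] -/
theorem isingWeight_free_zero_neg (Λ : Finset V) (β : ℝ) (τ : Λ → ℤˣ) :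
    isingWeight G Λ β 0 .free (-τ) = isingWeight G Λ β 0 .free τ := by
  rw [isingWeight, isingWeight, isingHamiltonian_free_zero_glue_neg]

/-- **Odd free correlations vanish at zero field** (Friedli–Velenik 2017, §3.7.1, eq. (3.33):
`⟨σ_A⟩^∅_{Λ;β,0} = 0` for `A ⊆ Λ` with `|A|` odd), by the change of variables `τ ↦ -τ` in the
Boltzmann sums. [cite: FriedliVelenik2017, §3.7.1, eq. (3.33)] -/
theorem isingCorr_free_zero_of_odd (Λ : Finset V) (β : ℝ) {A : Finset V} (hA : A ⊆ Λ)
    (hodd : Odd #A) : isingCorr G Λ β 0 .free A = 0 := by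
  rw [isingCorr, isingExpect_eq_sum_div G Λ 0 .free β (measurable_spinProduct A)]
  set S := ∑ τ : Λ → ℤˣ, isingWeight G Λ β 0 .free τ * spinProduct A (glue Λ τ .free) with hS
  have h1 : S = ∑ τ : Λ → ℤˣ,
      isingWeight G Λ β 0 .free (-τ) * spinProduct A (glue Λ (-τ) .free) :=
    (Fintype.sum_bijective (fun τ : Λ → ℤˣ => -τ) neg_involutive.bijective _ _ fun _ => rfl).symm
  have h2 : ∑ τ : Λ → ℤˣ, isingWeight G Λ β 0 .free (-τ) * spinProduct A (glue Λ (-τ) .free) =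
      -S := by
    rw [hS, ← Finset.sum_neg_distrib]
    refine Finset.sum_congr rfl fun τ _ => ?_
    rw [isingWeight_free_zero_neg, spinProduct_glue_neg_of_subset hA, hodd.neg_one_pow]
    ring
  have hS0 : S = 0 := by linarith
  rw [hS0, zero_div]

/-- **Discharge of the prelude fact `isingCorr_free_of_odd_card`** (`IsingModel`; Friedli–Velenik
2017, §3.7.1, eq. (3.33)): with free boundary condition and zero field, odd correlations vanish. [cite: FriedliVelenik2017, §3.7.1, eq. (3.33)] -/
theorem isingCorr_free_of_odd_card_holds : isingCorr_free_of_odd_card G :=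
  fun Λ β _ hA hodd => isingCorr_free_zero_of_odd G Λ β hA hodd

end SpinFlip

/-! ### The increasing indicators `n_A` and their finite-volume expectations -/

section Indicators

variable {V : Type*} (G : SimpleGraph V) [DecidableEq V] [G.LocallyFinite]

/-- `n_A = 2^{-|A|} ∑_{D ⊆ A} σ_D` (Friedli–Velenik 2017, Lemma 3.19, the inverse expansion). [cite: FriedliVelenik2017, Lemma 3.19] -/
theorem plusIndicator_eq_sum_spinProduct (A : Finset V) (σ : SpinConfig V) :
    plusIndicator A σ = ((2 : ℝ) ^ #A)⁻¹ * ∑ D ∈ A.powerset, spinProduct D σ := by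
  rw [sum_powerset_spinProduct, plusIndicator, Finset.prod_div_distrib, Finset.prod_const,
    div_eq_inv_mul]
  congr 1
  exact Finset.prod_congr rfl fun x _ => add_comm _ _

/-- `⟨n_A⟩^{bc}_{Λ;β,h} = 2^{-|A|} ∑_{D ⊆ A} ⟨σ_D⟩^{bc}_{Λ;β,h}` (linearity). [cite: FriedliVelenik2017, Lemma 3.19] -/
theorem isingExpect_plusIndicator (Λ : Finset V) (β h : ℝ) (bc : BoundaryCondition V)
    (A : Finset V) :
    isingExpect G Λ β h bc (plusIndicator A) =
      ((2 : ℝ) ^ #A)⁻¹ * ∑ D ∈ A.powerset, isingCorr G Λ β h bc D := by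
  have hfun : plusIndicator (V := V) A =
      fun σ => ((2 : ℝ) ^ #A)⁻¹ * ∑ D ∈ A.powerset, spinProduct D σ :=
    funext (plusIndicator_eq_sum_spinProduct A)
  rw [hfun, isingExpect_const_mul' G Λ h bc β _
      (Finset.measurable_sum _ fun D _ => measurable_spinProduct D),
    isingExpect_finset_sum' G Λ h bc β _ _ fun D => measurable_spinProduct D]
  rfl

/-- **Friedli–Velenik 2017, Exercise 3.10**: `∑_{i ∈ A} n_i − n_A` is nondecreasing. [cite: FriedliVelenik2017, Exercise 3.10] -/
theorem monotone_sum_plusIndicator_sub (A : Finset V) :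
    Monotone fun σ : SpinConfig V => ∑ i ∈ A, plusIndicator {i} σ - plusIndicator A σ := by
  intro σ σ' hle
  have hsing : ∀ (ρ : SpinConfig V) (i : V), plusIndicator {i} ρ = if ρ i = 1 then 1 else 0 :=
    fun ρ i => by rw [plusIndicator_eq]; simp
  have hle1 : ∀ (ρ : SpinConfig V) (i : V), plusIndicator {i} ρ ≤ 1 := fun ρ i => by
    rw [hsing]; split_ifs <;> norm_num
  have hnn1 : ∀ (ρ : SpinConfig V) (i : V), 0 ≤ plusIndicator {i} ρ := fun ρ i =>
    plusIndicator_nonneg _ _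
  simp only
  by_cases hA' : ∀ x ∈ A, σ' x = 1
  · -- `n_A(σ') = 1` and `∑ n_i(σ') = |A|`
    have h1 : plusIndicator A σ' = 1 := by rw [plusIndicator_eq, if_pos hA']
    have h2 : ∑ i ∈ A, plusIndicator {i} σ' = #A := by
      rw [Finset.card_eq_sum_ones, Nat.cast_sum, Nat.cast_one]
      exact Finset.sum_congr rfl fun i hi => by rw [hsing, if_pos (hA' i hi)]
    rw [h1, h2]
    by_cases hA : ∀ x ∈ A, σ x = 1
    · have h3 : plusIndicator A σ = 1 := by rw [plusIndicator_eq, if_pos hA]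
      have h4 : ∑ i ∈ A, plusIndicator {i} σ = #A := by
        rw [Finset.card_eq_sum_ones, Nat.cast_sum, Nat.cast_one]
        exact Finset.sum_congr rfl fun i hi => by rw [hsing, if_pos (hA i hi)]
      rw [h3, h4]
    · have h3 : plusIndicator A σ = 0 := by rw [plusIndicator_eq, if_neg hA]
      push Not at hA
      obtain ⟨x, hx, hx1⟩ := hA
      have h4 : ∑ i ∈ A, plusIndicator {i} σ ≤ #A - 1 := by
        rw [← Finset.add_sum_erase A _ hx, hsing, if_neg hx1, zero_add]
        calc ∑ i ∈ A.erase x, plusIndicator {i} σ ≤ ∑ i ∈ A.erase x, (1 : ℝ) :=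
              Finset.sum_le_sum fun i _ => hle1 σ i
          _ = #(A.erase x) := by simp
          _ = #A - 1 := by
              rw [Finset.card_erase_of_mem hx, Nat.cast_sub (Finset.card_pos.2 ⟨x, hx⟩)]
              simp
      rw [h3]
      linarith
  · -- `n_A(σ') = 0`, hence `n_A(σ) = 0`
    have h1 : plusIndicator A σ' = 0 := by rw [plusIndicator_eq, if_neg hA']
    have hA : ¬ ∀ x ∈ A, σ x = 1 := fun hA => hA' fun x hx =>
      intUnits_eq_one_of_one_le ((hA x hx) ▸ hle x)
    have h2 : plusIndicator A σ = 0 := by rw [plusIndicator_eq, if_neg hA]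
    rw [h1, h2, sub_zero, sub_zero]
    exact Finset.sum_le_sum fun i _ => plusIndicator_mono {i} hle

/-- The expectation of `∑_{i∈A} n_i − n_A` in terms of correlations (linearity). [folklore] -/
theorem isingExpect_sum_plusIndicator_sub (Λ : Finset V) (β h : ℝ) (bc : BoundaryCondition V)
    (A : Finset V) :
    isingExpect G Λ β h bc (fun σ => ∑ i ∈ A, plusIndicator {i} σ - plusIndicator A σ) =
      ∑ i ∈ A, isingExpect G Λ β h bc (plusIndicator {i}) -
        isingExpect G Λ β h bc (plusIndicator A) := by
  have hm : ∀ B : Finset V, Measurable (plusIndicator (V := V) B) := fun B =>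
    measurable_plusIndicator B
  have e1 : (fun σ : SpinConfig V => ∑ i ∈ A, plusIndicator {i} σ - plusIndicator A σ) =
      fun σ => (∑ i ∈ A, plusIndicator {i} σ) + (-1) * plusIndicator A σ := by
    funext σ; ring
  rw [e1, isingExpect_add' G Λ h bc β (Finset.measurable_sum _ fun i _ => hm {i})
      ((hm A).const_mul _), isingExpect_finset_sum' G Λ h bc β _ _ fun i => hm {i},
    isingExpect_const_mul' G Λ h bc β _ (hm A)]
  ring

end Indicators

/-! ### The Lebowitz–Martin-Löf criterion on `ℤ^d`: `m* = 0` forces `⟨·⟩^∅ = ⟨·⟩⁺` -/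

section LebowitzMartinLof

variable {d : ℕ}

/-- The correlation of the empty set is `1` in every finite volume. [folklore] -/
theorem isingCorr_empty {V : Type*} (G : SimpleGraph V) [DecidableEq V] [G.LocallyFinite]
    (Λ : Finset V) (β h : ℝ) (bc : BoundaryCondition V) : isingCorr G Λ β h bc ∅ = 1 := by
  have h1 : spinProduct (∅ : Finset V) = fun _ : SpinConfig V => (1 : ℝ) := funext fun σ => by
    simp [spinProduct]
  rw [isingCorr, h1]
  exact isingExpect_const G Λ β h bc 1

/-- `⟨σ_∅⟩^∅_{β,h} = 1` for `β, h ≥ 0`. [folklore] -/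
theorem freeCorr_empty {β h : ℝ} (hβ : 0 ≤ β) (hh : 0 ≤ h) : freeCorr d β h ∅ = 1 := by
  have hlim := hasBoxLimit_isingCorr_free_holds (d := d) hβ hh (∅ : Finset (Site d))
  simp only [isingCorr_empty] at hlim
  exact tendsto_nhds_unique hlim tendsto_const_nhds

/-- `⟨σ_∅⟩⁺_{β,h} = 1` for `β, h ≥ 0`. [folklore] -/
theorem plusCorr_empty {β h : ℝ} (hβ : 0 ≤ β) (hh : 0 ≤ h) : plusCorr d β h ∅ = 1 := by
  have hlim := hasBoxLimit_isingCorr_plus_holds (d := d) hβ hh (∅ : Finset (Site d))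
  simp only [isingCorr_empty] at hlim
  exact tendsto_nhds_unique hlim tendsto_const_nhds

/-- **The free state is even**: `⟨σ_{{i}}⟩^∅_{β,0} = 0` (limit of the vanishing odd finite-volume
free correlations, Friedli–Velenik 2017, eq. (3.33)). [cite: FriedliVelenik2017, §3.7.1, eq. (3.33)] -/
theorem freeCorr_singleton_eq_zero {β : ℝ} (hβ : 0 ≤ β) (i : Site d) : freeCorr d β 0 {i} = 0 := by
  have hlim := hasBoxLimit_isingCorr_free_holds (d := d) hβ le_rfl ({i} : Finset (Site d))
  have hev : ∀ᶠ L : ℕ in atTop, isingCorr (zdGraph d) (box d L) β 0 .free {i} = 0 := by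
    filter_upwards [eventually_mem_box i] with L hL
    exact isingCorr_free_zero_of_odd (zdGraph d) (box d L) β (Finset.singleton_subset_iff.2 hL)
      (by simp)
  have h0 : Tendsto (fun L : ℕ => isingCorr (zdGraph d) (box d L) β 0 .free {i}) atTop (𝓝 0) :=
    tendsto_const_nhds.congr' (hev.mono fun L hL => hL.symm)
  exact tendsto_nhds_unique hlim h0

/-- The box limit of `⟨n_B⟩^∅_{Λ(L);β,0}` is `2^{-|B|} ∑_{D⊆B} ⟨σ_D⟩^∅_{β,0}`. [cite: FriedliVelenik2017, Lemma 3.19 and Exercise 3.16] -/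
theorem tendsto_isingExpect_free_plusIndicator {β : ℝ} (hβ : 0 ≤ β) (B : Finset (Site d)) :
    Tendsto (fun L : ℕ => isingExpect (zdGraph d) (box d L) β 0 .free (plusIndicator B)) atTop
      (𝓝 (((2 : ℝ) ^ #B)⁻¹ * ∑ D ∈ B.powerset, freeCorr d β 0 D)) := by
  simp only [isingExpect_plusIndicator]
  exact (tendsto_finsetSum _ fun D _ =>
    hasBoxLimit_isingCorr_free_holds (d := d) hβ le_rfl D).const_mul _

/-- The box limit of `⟨n_B⟩⁺_{Λ(L);β,0}` is `2^{-|B|} ∑_{D⊆B} ⟨σ_D⟩⁺_{β,0}`. [cite: FriedliVelenik2017, Lemma 3.19 and Thm. 3.17] -/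
theorem tendsto_isingExpect_plus_plusIndicator' {β : ℝ} (hβ : 0 ≤ β) (B : Finset (Site d)) :
    Tendsto (fun L : ℕ => isingExpect (zdGraph d) (box d L) β 0 .plus (plusIndicator B)) atTop
      (𝓝 (((2 : ℝ) ^ #B)⁻¹ * ∑ D ∈ B.powerset, plusCorr d β 0 D)) := by
  simp only [isingExpect_plusIndicator]
  exact (tendsto_finsetSum _ fun D _ =>
    hasBoxLimit_isingCorr_plus_holds (d := d) hβ le_rfl D).const_mul _

/-- `⟨n_A⟩^∅_{β,0} ≤ ⟨n_A⟩⁺_{β,0}` in the limit (Holley domination in finite volume, `L → ∞`). [cite: FriedliVelenik2017, Thm. 3.28 (proof of 3 ⇒ 2)] -/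
theorem powersetSum_freeCorr_le_plusCorr {β : ℝ} (hβ : 0 ≤ β) (A : Finset (Site d)) :
    ((2 : ℝ) ^ #A)⁻¹ * ∑ D ∈ A.powerset, freeCorr d β 0 D ≤
      ((2 : ℝ) ^ #A)⁻¹ * ∑ D ∈ A.powerset, plusCorr d β 0 D :=
  le_of_tendsto_of_tendsto' (tendsto_isingExpect_free_plusIndicator hβ A)
    (tendsto_isingExpect_plus_plusIndicator' hβ A) fun L =>
    isingExpect_free_le_plus_of_monotone (zdGraph d) (box d L) hβ 0 (plusIndicator_mono A)
      (measurable_plusIndicator A)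

/-- `⟨∑_{i∈A} n_i − n_A⟩^∅_{β,0} ≤ ⟨∑_{i∈A} n_i − n_A⟩⁺_{β,0}` in the limit (Holley domination of the
nondecreasing function of Friedli–Velenik 2017, Exercise 3.10, `L → ∞`). [cite: FriedliVelenik2017, Thm. 3.28 (proof of 3 ⇒ 2)] -/
theorem sum_sub_powersetSum_freeCorr_le_plusCorr {β : ℝ} (hβ : 0 ≤ β) (A : Finset (Site d)) :
    ∑ i ∈ A, ((2 : ℝ) ^ #({i} : Finset (Site d)))⁻¹ *
          ∑ D ∈ ({i} : Finset (Site d)).powerset, freeCorr d β 0 D -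
        ((2 : ℝ) ^ #A)⁻¹ * ∑ D ∈ A.powerset, freeCorr d β 0 D ≤
      ∑ i ∈ A, ((2 : ℝ) ^ #({i} : Finset (Site d)))⁻¹ *
          ∑ D ∈ ({i} : Finset (Site d)).powerset, plusCorr d β 0 D -
        ((2 : ℝ) ^ #A)⁻¹ * ∑ D ∈ A.powerset, plusCorr d β 0 D := by
  have hmeas : Measurable fun σ : SpinConfig (Site d) =>
      ∑ i ∈ A, plusIndicator {i} σ - plusIndicator A σ :=
    (Finset.measurable_sum _ fun i _ => measurable_plusIndicator {i}).sub
      (measurable_plusIndicator A)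
  have tgf : Tendsto (fun L : ℕ => isingExpect (zdGraph d) (box d L) β 0 .free
      (fun σ => ∑ i ∈ A, plusIndicator {i} σ - plusIndicator A σ)) atTop
      (𝓝 (∑ i ∈ A, ((2 : ℝ) ^ #({i} : Finset (Site d)))⁻¹ *
          ∑ D ∈ ({i} : Finset (Site d)).powerset, freeCorr d β 0 D -
        ((2 : ℝ) ^ #A)⁻¹ * ∑ D ∈ A.powerset, freeCorr d β 0 D)) := by
    simp only [isingExpect_sum_plusIndicator_sub]
    exact (tendsto_finsetSum _ fun i _ => tendsto_isingExpect_free_plusIndicator hβ {i}).sub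
      (tendsto_isingExpect_free_plusIndicator hβ A)
  have tgp : Tendsto (fun L : ℕ => isingExpect (zdGraph d) (box d L) β 0 .plus
      (fun σ => ∑ i ∈ A, plusIndicator {i} σ - plusIndicator A σ)) atTop
      (𝓝 (∑ i ∈ A, ((2 : ℝ) ^ #({i} : Finset (Site d)))⁻¹ *
          ∑ D ∈ ({i} : Finset (Site d)).powerset, plusCorr d β 0 D -
        ((2 : ℝ) ^ #A)⁻¹ * ∑ D ∈ A.powerset, plusCorr d β 0 D)) := by
    simp only [isingExpect_sum_plusIndicator_sub]
    exact (tendsto_finsetSum _ fun i _ => tendsto_isingExpect_plus_plusIndicator' hβ {i}).sub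
      (tendsto_isingExpect_plus_plusIndicator' hβ A)
  exact le_of_tendsto_of_tendsto' tgf tgp fun L =>
    isingExpect_free_le_plus_of_monotone (zdGraph d) (box d L) hβ 0
      (monotone_sum_plusIndicator_sub A) hmeas

/-- A sum over the subsets of a singleton. [folklore] -/
theorem sum_powerset_singleton (i : Site d) (f : Finset (Site d) → ℝ) :
    ∑ D ∈ ({i} : Finset (Site d)).powerset, f D = f ∅ + f {i} := by
  have h : ({i} : Finset (Site d)).powerset = {∅, {i}} := by
    ext D
    rw [Finset.mem_powerset, Finset.subset_singleton_iff, Finset.mem_insert, Finset.mem_singleton]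
  rw [h, Finset.sum_pair]
  exact (Finset.singleton_ne_empty i).symm

/-- **The Lebowitz–Martin-Löf uniqueness criterion, free/plus form** (Lebowitz–Martin-Löf, CMP 25
(1972) 276, Theorem: at `h = 0` the equilibrium state is unique iff `m*(β) = 0`; Friedli–Velenik
2017, Thm. 3.28, proof of 3 ⇒ 2, and the remark before Def. 3.32: "when `h = 0`, uniqueness is
equivalent to `m*(β) = 0`"). For the nearest-neighbour Ising model on `ℤ^d` at `β ≥ 0` and zero
field: if `m*(β) = 0` then the free and plus states agree on every spin product,
`⟨σ_A⟩^∅_{β,0} = ⟨σ_A⟩⁺_{β,0}`. Proof (Friedli–Velenik's, run between `∅` and `+`): by Holley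
domination in finite volume and passage to the box limits, `⟨n_A⟩^∅ ≤ ⟨n_A⟩⁺` and
`⟨∑_{i∈A} n_i − n_A⟩^∅ ≤ ⟨∑_{i∈A} n_i − n_A⟩⁺`; since `⟨n_i⟩^∅ = ½ = ⟨n_i⟩⁺` when `m* = 0` (the free
state is even), `⟨n_A⟩^∅ = ⟨n_A⟩⁺` for all `A`, i.e. `∑_{D⊆A} ⟨σ_D⟩^∅ = ∑_{D⊆A} ⟨σ_D⟩⁺`, and Möbius
inversion over `A` concludes. [cite: LebowitzMartinlof1972, Theorem] [cite: FriedliVelenik2017, Thm. 3.28 (proof of 3 ⇒ 2)] -/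
theorem freeCorr_eq_plusCorr_of_spontaneousMagnetization_eq_zero {β : ℝ} (hβ : 0 ≤ β)
    (hm : spontaneousMagnetization d β = 0) (A : Finset (Site d)) :
    freeCorr d β 0 A = plusCorr d β 0 A := by
  -- Step 1: the expectations of `n_A` agree, i.e. `∑_{D ⊆ A} ⟨σ_D⟩^∅ = ∑_{D ⊆ A} ⟨σ_D⟩⁺`
  have hsum : ∀ A : Finset (Site d),
      ∑ D ∈ A.powerset, freeCorr d β 0 D = ∑ D ∈ A.powerset, plusCorr d β 0 D := by
    intro A
    have l1 := powersetSum_freeCorr_le_plusCorr (d := d) hβ A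
    have l2 := sum_sub_powersetSum_freeCorr_le_plusCorr (d := d) hβ A
    -- on singletons the two states agree when `m* = 0`
    have hs : ∀ i : Site d,
        ((2 : ℝ) ^ #({i} : Finset (Site d)))⁻¹ *
            ∑ D ∈ ({i} : Finset (Site d)).powerset, freeCorr d β 0 D =
          ((2 : ℝ) ^ #({i} : Finset (Site d)))⁻¹ *
            ∑ D ∈ ({i} : Finset (Site d)).powerset, plusCorr d β 0 D := by
      intro i
      have hpi : plusCorr d β 0 {i} = 0 := by
        rw [plusCorr, spinProduct_singleton,
          Literature.Probability.LatticeModels.plusExpect_spinAt_eq_spontaneousMagnetization_holds hβ i, hm]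
      rw [sum_powerset_singleton, sum_powerset_singleton, freeCorr_empty hβ le_rfl,
        plusCorr_empty hβ le_rfl, freeCorr_singleton_eq_zero hβ i, hpi]
    have hle : ((2 : ℝ) ^ #A)⁻¹ * ∑ D ∈ A.powerset, plusCorr d β 0 D ≤
        ((2 : ℝ) ^ #A)⁻¹ * ∑ D ∈ A.powerset, freeCorr d β 0 D := by
      have : ∑ i ∈ A, ((2 : ℝ) ^ #({i} : Finset (Site d)))⁻¹ *
            ∑ D ∈ ({i} : Finset (Site d)).powerset, freeCorr d β 0 D =
          ∑ i ∈ A, ((2 : ℝ) ^ #({i} : Finset (Site d)))⁻¹ *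
            ∑ D ∈ ({i} : Finset (Site d)).powerset, plusCorr d β 0 D :=
        Finset.sum_congr rfl fun i _ => hs i
      linarith
    have h2 : ((2 : ℝ) ^ #A)⁻¹ ≠ 0 := by positivity
    exact mul_left_cancel₀ h2 (le_antisymm l1 hle)
  -- Step 2: Möbius inversion, by strong induction on `A`
  induction A using Finset.strongInduction with
  | H A ih =>
    have h := hsum A
    rw [← Finset.add_sum_erase _ _ (Finset.mem_powerset_self A),
      ← Finset.add_sum_erase _ _ (Finset.mem_powerset_self A)] at h
    have hrest : ∑ D ∈ A.powerset.erase A, freeCorr d β 0 D =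
        ∑ D ∈ A.powerset.erase A, plusCorr d β 0 D := by
      refine Finset.sum_congr rfl fun D hD => ?_
      rw [Finset.mem_erase, Finset.mem_powerset] at hD
      exact ih D (Finset.ssubset_iff_subset_ne.2 ⟨hD.2, hD.1⟩)
    linarith

/-- In particular the free and plus two-point functions agree when `m*(β) = 0`:
`⟨σ₀σ_x⟩^∅_{β,0} = ⟨σ₀σ_x⟩⁺_{β,0}` (Lebowitz–Martin-Löf 1972; the case used by
Benettin–Gallavotti–Jona-Lasinio–Stella 1973, §3 d)). [cite: LebowitzMartinlof1972, Theorem] -/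
theorem twoPointFree_eq_twoPointPlus_of_spontaneousMagnetization_eq_zero {β : ℝ} (hβ : 0 ≤ β)
    (hm : spontaneousMagnetization d β = 0) (x : Site d) :
    twoPointFree d β x = twoPointPlus d β x := by
  by_cases hx : x = 0
  · subst hx
    rw [Literature.Probability.LatticeModels.twoPointFree_zero, twoPointPlus_zero]
  · rw [twoPointFree_eq_freeCorr β hx, twoPointPlus_eq_plusCorr β hx]
    exact freeCorr_eq_plusCorr_of_spontaneousMagnetization_eq_zero hβ hm _

end LebowitzMartinLof

/-! ### On `ℤ^d`: exponential decay of the free two-point function forces `m* = 0` -/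

section ExpDecay

variable {d : ℕ}

/-- **Exponential decay of the free two-point function forces `m*(β) = 0`** (the mechanism of
Lebowitz, CMP 28 (1972), §§II–III: a uniform exponential bound on the zero-field free pair
correlation implies the absence of spontaneous magnetisation — there via the differentiability
of the pressure in `h`, here via the GHS boundary-field bound of the tree,
`Literature.Probability.LatticeModels.spontaneousMagnetization_le_boundary_twoPoint` of `MeanFieldBoundGHS`). For the
nearest-neighbour Ising model on `ℤ^d`, `β ≥ 0`: if `⟨σ₀σ_x⟩^∅_{β,0} ≤ K e^{-κ‖x‖_∞}` for all `x`,
with `κ > 0`, then `m*(β) = 0`. Proof: `m*(β) ≤ β ∑_{x ∈ Λ_L} ∑_{y ∼ x, y ∉ Λ_L} ⟨σ₀σ_x⟩^∅_{Λ_L}`, the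
sites `x` with a neighbour outside the box have `‖x‖_∞ = L`, the finite-volume free two-point
function is below the infinite-volume one (GKS), so the right side is at most
`β · 2d(2L+1)^d · K e^{-κL} → 0`. [cite: Lebowitz1972, §III, Lemma 2 with eq. (3.3) and §II] -/
theorem spontaneousMagnetization_eq_zero_of_twoPointFree_exp_decay {β : ℝ} (hβ : 0 ≤ β)
    {K κ : ℝ} (hκ : 0 < κ) (hdec : ∀ x : Site d, twoPointFree d β x ≤ K * Real.exp (-κ * ‖x‖)) :
    spontaneousMagnetization d β = 0 := by
  classical
  have hK0 : 0 ≤ K := by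
    have h := hdec 0
    rw [Literature.Probability.LatticeModels.twoPointFree_zero, norm_zero, mul_zero, Real.exp_zero, mul_one] at h
    linarith
  -- the finite-volume free two-point functions are below the decaying infinite-volume one
  have hterm : ∀ (L : ℕ), ∀ x ∈ box d L, ∀ y ∈ ((zdGraph d).neighborFinset x).filter (· ∉ box d L),
      isingTwoPoint (zdGraph d) (box d L) β 0 .free 0 x ≤ K * Real.exp (-κ * L) := by
    intro L x hx y hy
    rw [Finset.mem_filter, SimpleGraph.mem_neighborFinset] at hy
    have hn : Site.supNorm x = L := Literature.Probability.LatticeModels.supNorm_eq_of_mem_box_of_adj_not_mem hx hy.2 hy.1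
    by_cases hx0 : x = 0
    · subst hx0
      have hL : L = 0 := by rw [Site.supNorm_eq_zero_iff.2 rfl] at hn; exact hn.symm
      subst hL
      rw [isingTwoPoint_self]
      have h := hdec 0
      rw [Literature.Probability.LatticeModels.twoPointFree_zero, norm_zero] at h
      simpa using h
    · calc isingTwoPoint (zdGraph d) (box d L) β 0 .free 0 x
          = isingCorr (zdGraph d) (box d L) β 0 .free {0, x} :=
            isingTwoPoint_eq_isingCorr _ _ _ _ _ (Ne.symm hx0)
        _ ≤ freeCorr d β 0 {0, x} := isingCorr_free_box_le_freeCorr hβ le_rfl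
            (Finset.insert_subset_iff.2 ⟨zero_mem_box d L, Finset.singleton_subset_iff.2 hx⟩)
        _ = twoPointFree d β x := (twoPointFree_eq_freeCorr β hx0).symm
        _ ≤ K * Real.exp (-κ * ‖x‖) := hdec x
        _ = K * Real.exp (-κ * L) := by rw [Site.norm_eq_supNorm, hn]
  -- the boundary-field bound on boxes
  have hbound : ∀ L : ℕ, spontaneousMagnetization d β ≤
      β * ((2 * d : ℝ) * (2 * L + 1 : ℝ) ^ d * (K * Real.exp (-κ * L))) := by
    intro L
    refine (Literature.Probability.LatticeModels.spontaneousMagnetization_le_boundary_twoPoint hβ L).trans ?_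
    refine mul_le_mul_of_nonneg_left ?_ hβ
    calc ∑ x ∈ box d L, ∑ y ∈ ((zdGraph d).neighborFinset x).filter (· ∉ box d L),
          isingTwoPoint (zdGraph d) (box d L) β 0 .free 0 x
        ≤ ∑ x ∈ box d L, ∑ _y ∈ ((zdGraph d).neighborFinset x).filter (· ∉ box d L),
            K * Real.exp (-κ * L) :=
          Finset.sum_le_sum fun x hx => Finset.sum_le_sum fun y hy => hterm L x hx y hy
      _ ≤ ∑ _x ∈ box d L, (2 * d : ℝ) * (K * Real.exp (-κ * L)) := by
          refine Finset.sum_le_sum fun x _ => ?_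
          rw [Finset.sum_const, nsmul_eq_mul]
          refine mul_le_mul_of_nonneg_right ?_ (by positivity)
          have h1 : #(((zdGraph d).neighborFinset x).filter (· ∉ box d L)) ≤ 2 * d :=
            (Finset.card_filter_le _ _).trans (Literature.Probability.LatticeModels.card_neighborFinset_zdGraph_le x)
          exact_mod_cast h1
      _ = (2 * d : ℝ) * (2 * L + 1 : ℝ) ^ d * (K * Real.exp (-κ * L)) := by
          rw [Finset.sum_const, nsmul_eq_mul, card_box]
          push_cast
          ring
  -- `(2L+1)^d e^{-κL} → 0`
  set r : ℝ := Real.exp (-κ) with hr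
  have hr0 : 0 < r := Real.exp_pos _
  have hr1 : r < 1 := Real.exp_lt_one_iff.2 (by linarith)
  have hpow : Tendsto (fun L : ℕ => (L : ℝ) ^ d * r ^ L) atTop (𝓝 0) :=
    tendsto_pow_const_mul_const_pow_of_abs_lt_one d (by rwa [abs_of_pos hr0])
  have hlim0 : Tendsto (fun L : ℕ => β * ((2 * d : ℝ) * (3 : ℝ) ^ d * K * ((L : ℝ) ^ d * r ^ L)))
      atTop (𝓝 0) := by
    have := (hpow.const_mul ((2 * d : ℝ) * (3 : ℝ) ^ d * K)).const_mul β
    simpa only [mul_zero] using this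
  have hev : ∀ᶠ L : ℕ in atTop, spontaneousMagnetization d β ≤
      β * ((2 * d : ℝ) * (3 : ℝ) ^ d * K * ((L : ℝ) ^ d * r ^ L)) := by
    filter_upwards [eventually_ge_atTop 1] with L hL
    refine (hbound L).trans (mul_le_mul_of_nonneg_left ?_ hβ)
    have hexp : Real.exp (-κ * L) = r ^ L := by
      rw [hr, ← Real.exp_nat_mul]
      congr 1
      ring
    have hL1 : (1 : ℝ) ≤ L := by exact_mod_cast hL
    have h3 : (2 * L + 1 : ℝ) ^ d ≤ (3 : ℝ) ^ d * (L : ℝ) ^ d := by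
      rw [← mul_pow]
      exact pow_le_pow_left₀ (by positivity) (by linarith) d
    rw [hexp]
    have hdn : (0 : ℝ) ≤ 2 * d := by positivity
    calc (2 * d : ℝ) * (2 * L + 1 : ℝ) ^ d * (K * r ^ L)
        ≤ (2 * d : ℝ) * ((3 : ℝ) ^ d * (L : ℝ) ^ d) * (K * r ^ L) :=
          mul_le_mul_of_nonneg_right (mul_le_mul_of_nonneg_left h3 hdn)
            (mul_nonneg hK0 (pow_nonneg hr0.le L))
      _ = (2 * d : ℝ) * (3 : ℝ) ^ d * K * ((L : ℝ) ^ d * r ^ L) := by ring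
  have hle : spontaneousMagnetization d β ≤ 0 := ge_of_tendsto hlim0 hev
  exact le_antisymm hle (spontaneousMagnetization_nonneg_holds hβ)

end ExpDecay

end Literature.Probability.LatticeModels
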